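import Summits.BirchSwinnertonDyer.Rank1Residual.P2.CongruentNumberSilentEvenFiveThetaCMGalois
import HarnessLib
import HarnessLib.Audit.Tags

/-!
# Cell «bsd-monsky» (prover-B): route B's descent operator `θ = σ_{1+ϖ}` BEYOND `k = 2` — the block tools,
# for GENERAL square-free `n ≡ 6 (mod 8)` (kernel lemmas; nothing asserted)

HONEST FRAMING (cell `bsd-monsky`, run/shared/lean/pub/bsd-monsky/; README §1/§3: the cell's CLAIMED theorem is Monsky's
conjecture on the `k = 2` family `𝒮⁻`; «ℓ ≥ 3 rungs (C-P2-2 for k ≥ 3) are NOT claimed — record what the same argument gives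
there, no more»). This file is that record IN THE KERNEL, part 1: the block evaluations (E5)/(E6) of PROOF-B §10 / the scope note
HOME/proof/PROOF-B-K3-SCOPE.md §2, proved for GENERAL `n` from the Literature display
`TianYuanZhang2017/CMPointGaloisDisplays.lean` (`CMBlockSpec`, `ThetaBlockSpec`, `SevenBlockSpec` — TYZ §3.1–3.2 / Prop. 3.2 /
Thm. 3.6 / p. 759 AS PRINTED, every block) and `GenusPointDescentDisplays.lean` (`thm35Main`, `lemma318`, `scriptLSpec`).
Nothing is asserted: every statement is a kernel implication from displayed printed sentences taken as data/hypotheses.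

* §1 `thetaPt` bookkeeping: `TrivialOnL` is closed under products/inverses; square-root transport (`g` fixes `y` and
  `x² = y²` ⟹ `g` fixes `x`; `g(x·y) = x·y`, `g x = −x` ⟹ `g y = −y`); `[i]τ((1−i)/2) = τ((1−i)/2) + τ(1)` and
  `[i]^k τ((1−i)/2) ∈ τ((1−i)/2) + ℤτ(1)`.
* §2 **(E6) for EVERY block `d ≡ 6 (mod 8)`** (`theta_sub_Z_of_six_block`): if `θ′ ∈ Gal(ℍ′_n/ℚ)` fixes `√−d` and
  `θ′·(θ^{(d)})⁻¹` is trivial on `L_d(i)` (`θ^{(d)}` = the block's own lift of `σ^{(d)}_{1+ϖ}`, (G8)), then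
  `(θ′ − 1)Z(d) ∈ g(d)·τ((1−i)/2) + ℤτ(1)` — PROOF-B (B1) for the top block (`θ′ = θ^{(n)}`), and the NEW comparison of two
  lifts through J759 «since `α` acts trivially on `L_n(i)`, `α ∈ 2Cl′_n`» for a proper sub-block.
The descent core for general `n ≡ 6 (mod 8)` is the companion file `P2/CongruentNumberThetaDescentCore.lean`; both are
consumed by `P2/CongruentNumberThetaThreePrimes.lean` (the `k = 3` type `(5, 5, 7)`).

References: [TianYuanZhang2017] §3.1 (J738–J739), Prop. 3.2 (2), Thm. 3.5, Thm. 3.6 (2) (J741), Lemma 3.18, proof of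
Lemma 3.21 (J759); HOME/proof/PROOF-B.md v1.3 §7–§8, §10; HOME/proof/PROOF-B-K3-SCOPE.md §2–§3 (prover-B g6).
-/

noncomputable section

open scoped Classical

open WeierstrassCurve WeierstrassCurve.Affine Literature.NumberTheory.EllipticCurves
  Literature.NumberTheory.EllipticCurves.Rank1Residual
  Literature.NumberTheory.EllipticCurves.Rank1Residual.Typed
  Literature.NumberTheory.EllipticCurves.TianYuanZhang2017
  Literature.NumberTheory.EllipticCurves.TianYuanZhang2017.W2

set_option autoImplicit false

namespace Summit.BirchSwinnertonDyer.Rank1Residual.P2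

namespace ThetaDescent

variable {n : ℕ}

/-! ## §1 Bookkeeping: `TrivialOnL`, square roots, `[i]` on `τ((1−i)/2)` -/

/-- `TrivialOnL d` is closed under products. [cite: TianYuanZhang2017, proof of Lemma 3.21 (J759 = p0020 L55–L58)] -/
theorem trivialOnL_mul (D : GenusPointData n) {d : ℕ} {a b : D.H ≃ₐ[ℚ] D.H} (ha : D.TrivialOnL d a)
    (hb : D.TrivialOnL d b) : D.TrivialOnL d (a * b) :=
  ⟨by rw [AlgEquiv.mul_apply, hb.1, ha.1], fun d' hd' h1 => by rw [AlgEquiv.mul_apply, hb.2 d' hd' h1, ha.2 d' hd' h1]⟩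

/-- `TrivialOnL d` is closed under inverses. [cite: TianYuanZhang2017, proof of Lemma 3.21 (J759 = p0020 L55–L58)] -/
theorem trivialOnL_inv (D : GenusPointData n) {d : ℕ} {a : D.H ≃ₐ[ℚ] D.H} (ha : D.TrivialOnL d a) :
    D.TrivialOnL d a⁻¹ :=
  ⟨inv_apply_of_apply_eq D a _ ha.1, fun d' hd' h1 => inv_apply_of_apply_eq D a _ (ha.2 d' hd' h1)⟩

/-- The inverse of an automorphism negating `x` negates `x`. [cite: TianYuanZhang2017, §3.1 (p0011 L60–L64)] -/
theorem inv_apply_eq_neg_of_apply_eq_neg (D : GenusPointData n) (g : D.H ≃ₐ[ℚ] D.H) {x : D.H} (h : g x = -x) :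
    g⁻¹ x = -x := by
  rw [AlgEquiv.aut_inv, AlgEquiv.symm_apply_eq, map_neg, h, neg_neg]

/-- If `g` fixes `x ≠ 0` and negates `x·y`, then it negates `y`. [cite: TianYuanZhang2017, §3.1 (p0011 L60–L64)] -/
theorem neg_of_neg_mul_left (D : GenusPointData n) (g : D.H ≃ₐ[ℚ] D.H) {x y : D.H} (hx : x ≠ 0) (hgx : g x = x)
    (hgxy : g (x * y) = -(x * y)) : g y = -y := by
  rw [map_mul, hgx] at hgxy
  have : x * (g y + y) = 0 := by linear_combination hgxy
  rcases mul_eq_zero.mp this with h | h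
  · exact absurd h hx
  · linear_combination h

/-- Square-root transport: if `x² = y²` and `g` fixes `y`, then `g` fixes `x` (`x = ±y`).
[cite: TianYuanZhang2017, §3.1 (p0011 L60–L64: K_d ⊂ L_n(i) ⊂ ℍ′_n)] -/
theorem fix_of_sq_eq_sq (D : GenusPointData n) (g : D.H ≃ₐ[ℚ] D.H) {x y : D.H} (hxy : x ^ 2 = y ^ 2)
    (hgy : g y = y) : g x = x := by
  rcases sq_eq_sq_iff_eq_or_eq_neg.mp hxy with h | h
  · rw [h, hgy]
  · rw [h, map_neg, hgy]

/-- Square-root transport: if `x² = y²` and `g y = −y`, then `g x = −x`. [cite: TianYuanZhang2017, §3.1 (p0011 L60–L64)] -/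
theorem neg_of_sq_eq_sq (D : GenusPointData n) (g : D.H ≃ₐ[ℚ] D.H) {x y : D.H} (hxy : x ^ 2 = y ^ 2)
    (hgy : g y = -y) : g x = -x := by
  rcases sq_eq_sq_iff_eq_or_eq_neg.mp hxy with h | h
  · rw [h, hgy]
  · rw [h, map_neg, hgy]

/-- If `g` fixes `x·y` and `x ≠ 0` is fixed, then `y` is fixed. [cite: TianYuanZhang2017, §3.1 (p0011 L60–L64)] -/
theorem fix_of_fix_mul_left (D : GenusPointData n) (g : D.H ≃ₐ[ℚ] D.H) {x y : D.H} (hx : x ≠ 0) (hgx : g x = x)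
    (hgxy : g (x * y) = x * y) : g y = y := by
  rw [map_mul, hgx] at hgxy
  exact mul_left_cancel₀ hx hgxy

/-- If `g` fixes `x·y` and negates `x ≠ 0`, then it negates `y`. [cite: TianYuanZhang2017, §3.1 (p0011 L60–L64)] -/
theorem neg_of_fix_mul_left (D : GenusPointData n) (g : D.H ≃ₐ[ℚ] D.H) {x y : D.H} (hx : x ≠ 0) (hgx : g x = -x)
    (hgxy : g (x * y) = x * y) : g y = -y := by
  rw [map_mul, hgx] at hgxy
  have : x * (g y + y) = 0 := by linear_combination -hgxy
  rcases mul_eq_zero.mp this with h | h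
  · exact absurd h hx
  · linear_combination h

/-- If `g` negates `x·y` and negates `x ≠ 0`, then it fixes `y`. [cite: TianYuanZhang2017, §3.1 (p0011 L60–L64)] -/
theorem fix_of_neg_mul_left (D : GenusPointData n) (g : D.H ≃ₐ[ℚ] D.H) {x y : D.H} (hx : x ≠ 0) (hgx : g x = -x)
    (hgxy : g (x * y) = -(x * y)) : g y = y := by
  rw [map_mul, hgx] at hgxy
  have : x * (g y - y) = 0 := by linear_combination -hgxy
  rcases mul_eq_zero.mp this with h | h
  · exact absurd h hx
  · linear_combination h

/-- `i ≠ 0` in `ℍ′_n`. [cite: TianYuanZhang2017, §3.1 (p0011 L60–L64)] -/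
theorem im_ne_zero (D : GenusPointData n) : D.im ≠ 0 := fun h => by
  have := D.im_sq; rw [h] at this; norm_num at this

/-- `[i]([i]Q) = −Q` on `A(ℍ′_n)` (`[i](X, Y) = (−X, iY)`, `i² = −1`). [cite: TianYuanZhang2017, §3.1 (p0011 L66)] -/
theorem iPt_iPt (D : GenusPointData n) (Q : APoint D.H) : D.iPt (D.iPt Q) = -Q := by
  rcases Q with _ | ⟨x, y, h⟩
  · show D.iPt (D.iPt 0) = -0
    simp only [map_zero, neg_zero]
  · change cmI D.im D.im_sq (cmI D.im D.im_sq (.some x y h)) = -(.some x y h)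
    rw [cmI_some, cmI_some, Point.neg_some]
    obtain ⟨h1, -, h3, -, -⟩ := curveA_baseChange_a (H := D.H)
    simp only [Point.some.injEq, negY, h1, h3, neg_neg]
    refine ⟨trivial, ?_⟩
    have hi := D.im_sq
    linear_combination y * hi

/-- `[i]τ((1−i)/2) = τ((1−i)/2) + τ(1)` (`[i](τ(1/2) − [i]τ(1/2)) = [i]τ(1/2) + τ(1/2)`, `2[i]τ(1/2) = τ(1)`).
[cite: TianYuanZhang2017, §3.2 (p0012 L8–L18)] -/
theorem iPt_tauHalfOneMinusI (D : GenusPointData n) : D.iPt D.tauHalfOneMinusI = D.tauHalfOneMinusI + tauOne := by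
  show D.iPt (tauHalf - D.iPt tauHalf) = (tauHalf - D.iPt tauHalf) + tauOne
  rw [map_sub, iPt_iPt, ← (tau_facts D).2.2.1]
  show D.iPt tauHalf - -tauHalf = tauHalf - D.iPt tauHalf + (2 : ℕ) • D.iPt tauHalf
  rw [two_nsmul]; abel

/-- `[i]^k τ((1−i)/2) ∈ τ((1−i)/2) + ℤτ(1)`. [cite: TianYuanZhang2017, §3.2 (p0012 L8–L18)] -/
theorem cmIPow_tauHalfOneMinusI (D : GenusPointData n) (k : ℕ) :
    ∃ j : ℤ, cmIPow D.im D.im_sq k D.tauHalfOneMinusI = D.tauHalfOneMinusI + j • tauOne := by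
  induction k with
  | zero => exact ⟨0, by simp [cmIPow]⟩
  | succ k ih =>
    obtain ⟨j, hj⟩ := ih
    refine ⟨j + 1, ?_⟩
    show D.iPt (cmIPow D.im D.im_sq k D.tauHalfOneMinusI) = _
    rw [hj, map_add, map_zsmul, iPt_tauHalfOneMinusI, iPt_tauOne, add_smul, one_smul]
    abel

/-- `[i]^k (m • τ(1)) = m • τ(1)`. [cite: TianYuanZhang2017, Lemma 3.16 (p0017 L105–L113)] -/
theorem cmIPow_zsmul_tauOne (D : GenusPointData n) (k : ℕ) (m : ℤ) :
    cmIPow D.im D.im_sq k (m • (tauOne : APoint D.H)) = m • tauOne := by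
  rw [map_zsmul, cmIPow_tauOne]

/-! ## §1b `ℤτ(1) = AddSubgroup.zmultiples τ(1)`; `θ − 1` past `[i]^e` -/

/-- `ℤτ(1)` is stable under `[i]^k` (`[i]τ(1) = τ(1)`). [cite: TianYuanZhang2017, Lemma 3.16 (p0017 L105–L113)] -/
theorem cmIPow_mem_zmultiples_tauOne (D : GenusPointData n) {x : APoint D.H}
    (hx : x ∈ AddSubgroup.zmultiples (tauOne : APoint D.H)) (k : ℕ) :
    cmIPow D.im D.im_sq k x ∈ AddSubgroup.zmultiples (tauOne : APoint D.H) := by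
  obtain ⟨a, rfl⟩ := AddSubgroup.mem_zmultiples_iff.mp hx
  rw [cmIPow_zsmul_tauOne]
  exact AddSubgroup.zsmul_mem _ (AddSubgroup.mem_zmultiples _) a

/-- Unpacking `x ∈ ℤτ(1)` as `x = k • τ(1)`. [cite: TianYuanZhang2017, Lemma 3.16 (p0017 L105–L113)] -/
theorem exists_eq_zsmul_of_mem_zmultiples_tauOne (D : GenusPointData n) {x : APoint D.H}
    (hx : x ∈ AddSubgroup.zmultiples (tauOne : APoint D.H)) : ∃ k : ℤ, x = k • tauOne := by
  obtain ⟨a, ha⟩ := AddSubgroup.mem_zmultiples_iff.mp hx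
  exact ⟨a, ha.symm⟩

/-- Packing `x = k • τ(1)` as `x ∈ ℤτ(1)`. [cite: TianYuanZhang2017, Lemma 3.16 (p0017 L105–L113)] -/
theorem mem_zmultiples_tauOne_of_eq_zsmul (D : GenusPointData n) {x : APoint D.H} {k : ℤ} (hx : x = k • tauOne) :
    x ∈ AddSubgroup.zmultiples (tauOne : APoint D.H) :=
  AddSubgroup.mem_zmultiples_iff.mpr ⟨k, hx.symm⟩

/-- `θ − 1` commutes with `[i]^e` for `e` even and with `𝓛 •` (`θ(i) = −i`). [cite: TianYuanZhang2017, §3.1 (p0011 L66–L73)] -/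
theorem theta_sub_cmIPow_even (D : GenusPointData n) (θ : D.H ≃ₐ[ℚ] D.H) (hθi : θ D.im = -D.im) {e : ℕ} (he : Even e)
    (L : ℤ) (X : APoint D.H) :
    thetaPt D θ (cmIPow D.im D.im_sq e (L • X)) - cmIPow D.im D.im_sq e (L • X) =
      cmIPow D.im D.im_sq e (L • (thetaPt D θ X - X)) := by
  rw [thetaPt_cmIPow D θ hθi, he.neg_one_pow, one_smul, map_zsmul, smul_sub, map_sub, map_zsmul, map_zsmul]

/-- For `e` odd: `(θ − 1)([i]^e(𝓛•X)) = −[i]^e(𝓛•(θX + X))`. [cite: TianYuanZhang2017, §3.1 (p0011 L66–L73), Thm. 3.3 (ε = ±i)] -/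
theorem theta_sub_cmIPow_odd (D : GenusPointData n) (θ : D.H ≃ₐ[ℚ] D.H) (hθi : θ D.im = -D.im) {e : ℕ} (he : Odd e)
    (L : ℤ) (X : APoint D.H) :
    thetaPt D θ (cmIPow D.im D.im_sq e (L • X)) - cmIPow D.im D.im_sq e (L • X) =
      -cmIPow D.im D.im_sq e (L • (thetaPt D θ X + X)) := by
  rw [thetaPt_cmIPow D θ hθi, he.neg_one_pow, neg_smul, one_smul, map_zsmul, smul_add, map_add, map_zsmul, map_zsmul]
  abel


/-! ## §1c (E5) for every block `p ≡ 5 (mod 8)` (a prime): `θ′Z(p) + Z(p) ∈ ℤτ(1)` when `θ′c` is trivial on `L_p(i)` -/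

/-- **(E5) for a prime block `p ≡ 5 (mod 8)`** (PROOF-B (B3) / `reflection_sum_thetaPt`, fed with the display's block-`p`
sentences (G1)–(G7), (G5) and `ConjSpec`): if `θ′(i) = −i` and `θ′(√p) = √p` (`√p = i√−p`), then `θ′·Z(p) + Z(p) ∈ ℤτ(1)`.
[cite: TianYuanZhang2017, Thm. 3.6 (1) (J741 = p0012 L27–L29), proof of Lemma 3.15 (J750), proof of Lemma 3.21 (J759 = p0020 L55–L62)] -/
theorem theta_Z_add_Z_mem_of_five (D : GenusPointData n) {p : ℕ} (hp : p.Prime) (hpn : p ∈ n.divisors) (hp5 : p % 8 = 5)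
    {zp : APoint D.H} {Φp : Finset (D.H ≃ₐ[ℚ] D.H)} {Γp Γp' : Subgroup (D.H ≃ₐ[ℚ] D.H)} {σp c : D.H ≃ₐ[ℚ] D.H}
    (hB : D.CMBlockSpec p zp Φp Γp Γp' σp c) (hci : c D.im = -D.im) (hcp : c (D.sqrtNeg p) = -D.sqrtNeg p)
    (hcc : c * c = 1) (θ' : D.H ≃ₐ[ℚ] D.H) (hθ'i : θ' D.im = -D.im)
    (hθ'rp : θ' (D.im * D.sqrtNeg p) = D.im * D.sqrtNeg p) :
    thetaPt D θ' (D.Z p) + D.Z p ∈ AddSubgroup.zmultiples (tauOne : APoint D.H) := by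
  obtain ⟨⟨hZp, -⟩, hΦp, ⟨hΓpz, hΓpn, habp⟩, ⟨-, hΓpgen⟩, ⟨hdih, hcz5, -⟩, ⟨hσH, hσσ, hσz⟩, ⟨hrep, huniq⟩⟩ := hB
  have hp2 : p ≠ 2 := by omega
  have hpodd : Odd p := hp.odd_of_ne_two hp2
  have hpp : p ∈ p.divisors := Nat.mem_divisors_self _ hp.ne_zero
  have hgp : D.genusRoot p = D.im * D.sqrtNeg p := by unfold GenusPointData.genusRoot; rw [if_pos (by omega)]
  have hsp0 : D.sqrtNeg p ≠ 0 := sqrtNeg_ne_zero D hpn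
  have hcz : thetaPt D c zp = -zp + tauOne := hcz5 hp5
  have hΓpz' : ∀ γ ∈ Γp', thetaPt D γ zp = zp := fun γ hγ => hΓpz γ hγ
  have hσz' : thetaPt D σp zp = zp + tauOne := hσz
  -- `σ` fixes `√−p` and `√p`, hence `i`
  obtain ⟨hσsp, hσgen⟩ := hΓpgen σp hσH
  have hσrp : σp (D.im * D.sqrtNeg p) = D.im * D.sqrtNeg p := by rw [← hgp]; exact hσgen p hpp hpodd hp.one_lt
  have hσi : σp D.im = D.im := fix_im_of_fix_mul D σp hsp0 hσsp hσrp
  -- `F` = "trivial on `L_p(i) = ℚ(i, √p)`"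
  let F : (D.H ≃ₐ[ℚ] D.H) → Prop := fun a => a D.im = D.im ∧ a (D.im * D.sqrtNeg p) = D.im * D.sqrtNeg p
  have hFsp : ∀ a, F a → a (D.sqrtNeg p) = D.sqrtNeg p := fun a ha => fix_of_fix_im_mul D a ha.1 _ ha.2
  have hFmul : ∀ a b, F a → F b → F (a * b) := fun a b ha hb =>
    ⟨by rw [AlgEquiv.mul_apply, hb.1, ha.1], by rw [AlgEquiv.mul_apply, hb.2, ha.2]⟩
  have hFinv : ∀ a, F a → F a⁻¹ := fun a ha =>
    ⟨inv_apply_of_apply_eq D a _ ha.1, inv_apply_of_apply_eq D a _ ha.2⟩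
  have hcomm : ∀ s t, F s → F t → s⁻¹ * t⁻¹ * s * t ∈ Γp' := fun s t hs ht => habp s t (hFsp s hs) (hFsp t ht)
  have hct : ∀ t, F t → c * t * c * t ∈ Γp' := fun t ht => hdih t (hFsp t ht)
  have hΦF : ∀ t ∈ Φp, F t := fun t ht =>
    ⟨(hΦp t ht).1, by rw [map_mul, (hΦp t ht).1, (hΦp t ht).2 p hpp hp.one_lt]⟩
  have hrep' : ∀ g, F g → ∃ r ∈ Φp, g * r⁻¹ ∈ Γp' ∨ g * (r * σp)⁻¹ ∈ Γp' := by
    intro g hg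
    refine hrep g ⟨hg.1, ?_⟩
    intro d' hd' hd'1
    rcases (Nat.dvd_prime hp).mp (Nat.mem_divisors.mp hd').1 with rfl | rfl
    · omega
    · exact hFsp g hg
  have hα : F (θ' * c) := by
    refine ⟨?_, ?_⟩
    · rw [AlgEquiv.mul_apply, hci, map_neg, hθ'i, neg_neg]
    · rw [AlgEquiv.mul_apply, map_mul, hci, hcp, neg_mul_neg, hθ'rp]
  have hg : θ' = θ' * c * c := by rw [mul_assoc, hcc, mul_one]
  obtain ⟨m, hm⟩ := reflection_sum_thetaPt D Γp' zp hΓpn hΓpz' F hFmul hFinv hcomm ⟨hσi, hσrp⟩ hσσ hσz' Φp hΦF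
    hrep' huniq hcc hct hcz (θ' * c) hα
  have hZp' : D.Z p = ∑ t ∈ Φp, thetaPt D t zp := hZp
  refine mem_zmultiples_tauOne_of_eq_zsmul D (k := m) ?_
  rw [hZp', hg]; exact hm

/-! ## §2 (E6) for every block `d ≡ 6 (mod 8)`: comparison of `θ′` with the block's own `σ_{1+ϖ}`-lift -/

section SixBlock

variable (D : GenusPointData n) (Γ : Subgroup (D.H ≃ₐ[ℚ] D.H)) (z : APoint D.H)

/-- **Left translation of a `Φ₀`-sum** (J759 mechanism «`αΦ₀` is also a set of representatives»): if `α` is trivial on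
`L_d(i)` then `Σ_{t∈Φ₀} (αt)·z = Σ_{t∈Φ₀} t·z + m·τ(1)`.
[cite: TianYuanZhang2017, proof of Lemma 3.21 (J759 = p0020 L55–L62); Thm. 3.6 (p0012 L27–L33)] -/
theorem sum_thetaPt_left_mul (hΓn : ∀ g γ, γ ∈ Γ → g * γ * g⁻¹ ∈ Γ) (hΓz : ∀ γ ∈ Γ, thetaPt D γ z = z)
    {d : ℕ} {σ : D.H ≃ₐ[ℚ] D.H} (hσσ : σ * σ ∈ Γ) (hσz : thetaPt D σ z = z + tauOne)
    (Φ : Finset (D.H ≃ₐ[ℚ] D.H)) (hΦ : ∀ t ∈ Φ, D.TrivialOnL d t)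
    (hrep : ∀ g : D.H ≃ₐ[ℚ] D.H, D.TrivialOnL d g → ∃ t ∈ Φ, g * t⁻¹ ∈ Γ ∨ g * (t * σ)⁻¹ ∈ Γ)
    (huniq : ∀ t₁ ∈ Φ, ∀ t₂ ∈ Φ, (t₁ * t₂⁻¹ ∈ Γ ∨ t₁ * (t₂ * σ)⁻¹ ∈ Γ) → t₁ = t₂)
    (α : D.H ≃ₐ[ℚ] D.H) (hα : D.TrivialOnL d α) :
    ∃ m : ℤ, ∑ t ∈ Φ, thetaPt D (α * t) z = ∑ t ∈ Φ, thetaPt D t z + m • tauOne := by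
  refine sum_thetaPt_reindex D Γ z hΓn hΓz hσσ hσz Φ (fun t => α * t)
    (fun t ht => hrep (α * t) (trivialOnL_mul D hα (hΦ t ht))) ?_
  intro t₁ ht₁ t₂ ht₂ h
  apply huniq t₁ ht₁ t₂ ht₂
  rcases h with h | h
  · left
    apply mem_of_conj_mem D Γ hΓn α
    rwa [show α * (t₁ * t₂⁻¹) * α⁻¹ = α * t₁ * (α * t₂)⁻¹ by group]
  · right
    apply mem_of_conj_mem D Γ hΓn α
    rwa [show α * (t₁ * (t₂ * σ)⁻¹) * α⁻¹ = α * t₁ * (α * t₂ * σ)⁻¹ by group]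

end SixBlock

/-- **(E6) for every block `d ≡ 6 (mod 8)` — `(θ′ − 1)Z(d) ∈ g(d)·τ((1−i)/2) + ℤτ(1)`.** Data: the block's printed
sentences `CMBlockSpec d` (G1)–(G7) and `ThetaBlockSpec d` (G8) for `z = z_d`, `Φ = Φ₀^{(d)}`, `ΓH = Gal(ℍ′/H_d) ⊇ ΓH' =
Gal(ℍ′/H′_d)`, `σ`, `θ^{(d)}` (a lift of `σ^{(d)}_{1+ϖ}`); an automorphism `θ′` fixing `√−d` such that `α = θ′·(θ^{(d)})⁻¹`
is trivial on `L_d(i)`. Then: `α ≡ r` or `rσ` modulo `Gal(ℍ′/H′_d)` for some `r ∈ Φ₀` (J759 «`α ∈ 2Cl′_n`»), so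
`θ′·z_d = r·z_d + τ((1−i)/2) + eτ(1)` (Thm. 3.6 (2), `z^σ = z + τ(1)`); summing over `Φ₀` (commuting `t` past `θ′` and `r`
by the commutator clause of (G3)) and re-indexing `rΦ₀` gives the claim. At `d = n`, `θ′ = θ^{(n)}` this is PROOF-B (B1).
[cite: TianYuanZhang2017, §3.1 (J738–J739 = p0011 L53–L58), Prop. 3.2 (2) (p0010 L111–L113), Thm. 3.6 (2) (J741 = p0012 L31–L33), proof of Lemma 3.21 (J759 = p0020 L55–L62)] -/
theorem theta_sub_Z_of_six_block (D : GenusPointData n) {d : ℕ} (hdd : d ∈ d.divisors) (hd1 : 1 < d)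
    {z : APoint D.H} {Φ : Finset (D.H ≃ₐ[ℚ] D.H)} {ΓH ΓH' : Subgroup (D.H ≃ₐ[ℚ] D.H)}
    {σ c θd : D.H ≃ₐ[ℚ] D.H} (hB : D.CMBlockSpec d z Φ ΓH ΓH' σ c) (hT : D.ThetaBlockSpec d z ΓH ΓH' σ θd)
    (θ' : D.H ≃ₐ[ℚ] D.H) (hθ'K : θ' (D.sqrtNeg d) = D.sqrtNeg d) (hα : D.TrivialOnL d (θ' * θd⁻¹)) :
    ∃ M : ℤ, thetaPt D θ' (D.Z d) - D.Z d = (gK d : ℤ) • D.tauHalfOneMinusI + M • tauOne := by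
  obtain ⟨⟨hZ, hcard⟩, hΦ, ⟨hΓ'z, hΓ'n, hcomm⟩, ⟨hΓ'Γ, hΓgen⟩, -, ⟨hσΓ, hσσ, hσz⟩, ⟨hrep, huniq⟩⟩ := hB
  obtain ⟨hθdK, ⟨m₀, h36⟩, hθdΓ, hθθσ⟩ := hT
  -- thetaPt / galPt
  have hΓ'z' : ∀ γ ∈ ΓH', thetaPt D γ z = z := fun γ hγ => hΓ'z γ hγ
  have hσz' : thetaPt D σ z = z + tauOne := hσz
  have h36' : thetaPt D θd z = z + D.tauHalfOneMinusI + m₀ • tauOne := h36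
  set α : D.H ≃ₐ[ℚ] D.H := θ' * θd⁻¹ with hαdef
  have hθ'eq : θ' = α * θd := by rw [hαdef]; group
  -- `t ∈ Φ₀` and `σ` fix `√−d`
  have htK : ∀ t ∈ Φ, t (D.sqrtNeg d) = D.sqrtNeg d := fun t ht => (hΦ t ht).2 d hdd hd1
  -- `α·z = r·z + e·τ(1)`
  obtain ⟨r, hr, hαr⟩ := hrep α hα
  obtain ⟨e, he⟩ : ∃ e : ℤ, thetaPt D α z = thetaPt D r z + e • tauOne := by
    rcases hαr with h | h
    · exact ⟨0, by rw [thetaPt_eq_of_mul_inv_mem D ΓH' z hΓ'n hΓ'z' h, zero_smul, add_zero]⟩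
    · exact ⟨1, by rw [one_smul]; exact thetaPt_eq_of_mul_inv_mem_sigma D ΓH' z hΓ'n hΓ'z' hσz' h⟩
  have hrK : r (D.sqrtNeg d) = D.sqrtNeg d := htK r hr
  -- `θ′·z = r·z + w + (e + m₀)τ(1)`
  have hαw : thetaPt D α D.tauHalfOneMinusI = D.tauHalfOneMinusI := thetaPt_tauHalfOneMinusI_of_fix D α hα.1
  have hθ'z : thetaPt D θ' z = thetaPt D r z + D.tauHalfOneMinusI + (e + m₀) • tauOne := by
    rw [hθ'eq, thetaPt_mul, h36', map_add, map_add, map_zsmul, hαw, thetaPt_tauOne' D α, he, add_smul]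
    abel
  -- commute `t` past `θ′` and past `r`
  have hcommθ : ∀ t ∈ Φ, thetaPt D θ' (thetaPt D t z) = thetaPt D t (thetaPt D θ' z) := fun t ht =>
    thetaPt_comm_of_commutator_mem D ΓH' z hΓ'z' θ' t (hcomm θ' t hθ'K (htK t ht))
  have hcommr : ∀ t ∈ Φ, thetaPt D t (thetaPt D r z) = thetaPt D r (thetaPt D t z) := fun t ht =>
    thetaPt_comm_of_commutator_mem D ΓH' z hΓ'z' t r (hcomm t r (htK t ht) hrK)
  -- `r·Z = Z + m₁τ(1)`
  obtain ⟨m₁, hm₁⟩ := sum_thetaPt_left_mul D ΓH' z hΓ'n hΓ'z' hσσ hσz' Φ hΦ hrep huniq r (hΦ r hr)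
  refine ⟨m₁ + (Φ.card : ℤ) * (e + m₀), ?_⟩
  have htw : ∀ t ∈ Φ, thetaPt D t D.tauHalfOneMinusI = D.tauHalfOneMinusI := fun t ht =>
    thetaPt_tauHalfOneMinusI_of_fix D t (hΦ t ht).1
  have hterm : ∀ t ∈ Φ, thetaPt D θ' (thetaPt D t z) =
      thetaPt D (r * t) z + (D.tauHalfOneMinusI + (e + m₀) • tauOne) := by
    intro t ht
    rw [hcommθ t ht, hθ'z, map_add, map_add, map_zsmul, htw t ht, thetaPt_tauOne' D t, hcommr t ht, thetaPt_mul,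
      add_assoc]
  have hZ' : D.Z d = ∑ t ∈ Φ, thetaPt D t z := hZ
  rw [hZ', map_sum, Finset.sum_congr rfl hterm, Finset.sum_add_distrib, hm₁, Finset.sum_const, hcard,
    ← natCast_zsmul]
  module

end ThetaDescent

end Summit.BirchSwinnertonDyer.Rank1Residual.P2

end
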